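import Mathlib
import HarnessLib
import Summits.PneNP.PneNP.Theorems.CnfIdealGenLengthRankDefectRepresentationsCutLemma

/-!
# The local cut inequality — registered stub `stub_localCut` (W12) of line `rank-dehn-ladder`
(crux `RankDefectRepresentations` = stmt-PneNP-18923, RESHAPE 13 of lead g16)

Rows `x : ι` and columns `y : ι'` of a matrix `R` over a field carry colours `row x, col y : Q`.  For a set of
colours `B` write `blk(X, Y) := R ∘ 1[(row ∈ X) × (col ∈ Y)]` and `μ(B) := rank blk(B, Bᶜ) + rank blk(Bᶜ, B)` (the
bipartition cut of `R` at `B`).  THEOREM (`stub_localCut`, Theorem 2 of `Lines/rank-dehn-ladder-N1-proof.md` at an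
ARBITRARY cut, with signed slack): assuming the one-sided decomposition with signed slack (the registered statement
of stub `stub_oneSidedSlack`, W11, taken here as an explicit hypothesis), for EVERY set of colours `B` the matrix `R` is
within rank `4 μ(B) + ∑_{i : Q} (μ(B ∆ {i}) − μ(B))` (a signed sum over all colours) of a matrix supported on the
equal-colour cells `{row x = col y}`.

Proof: put `δ i := μ(B ∆ {i}) − μ(B)`.  The hypothesis applied to `B` and `δ` (for `i ∈ B`, `B ∆ {i} = B.erase i`, so its
premise holds with equality) gives `P₁` supported on `{row = col ∈ B}` with `rank (blk(B,B) − P₁) ≤ 2 rank blk(B,Bᶜ) +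
rank blk(Bᶜ,B) + ∑_{i ∈ B} δ i`; applied to `Bᶜ` and `δ` (for `i ∉ B`, `Bᶜ.erase i = (B ∆ {i})ᶜ` and complementing a cut
swaps its two blocks — equality again) it gives `P₂` supported on `{row = col ∉ B}` with `rank (blk(Bᶜ,Bᶜ) − P₂) ≤
2 rank blk(Bᶜ,B) + rank blk(B,Bᶜ) + ∑_{i ∉ B} δ i`.  Assembling as in
`…CutLemma.exists_blockDiagonal_of_maxCut` (p642852): `R − (P₁ + P₂) = (blk(B,Bᶜ) + blk(Bᶜ,B)) + ((blk(B,B) − P₁) +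
(blk(Bᶜ,Bᶜ) − P₂))`, rank subadditivity, and `∑_{i∈B} δ i + ∑_{i∈Bᶜ} δ i = ∑_i δ i`.
HONEST FRAMING: an elementary linear-algebra tool of the AVERAGE-CUT lane; P ≠ NP is not moved; F-N2 is a FRONTIER formal rung.
-/

set_option linter.dupNamespace false -- `Summit.PneNP.PneNP.…`: summit = sub-problem name (D-0017)

namespace Summit.PneNP.PneNP.Theorems.CnfIdealGenLengthRankDefectRepresentationsLocalCut

open Finset Matrix
open Literature.Computability.AlgebraicComplexity (rank_add_le)

variable {K : Type} [Field K]
variable {ι ι' Q : Type} [Fintype ι] [Fintype ι'] [DecidableEq Q]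

omit [Fintype ι] [Fintype ι'] in
/-- For a colour `i ∈ B`, flipping `i` removes it: `B ∆ {i} = B.erase i`. [folklore] -/
theorem symmDiff_singleton_eq_erase_of_mem {B : Finset Q} {i : Q} (hi : i ∈ B) :
    symmDiff B {i} = B.erase i := by
  ext q
  simp only [Finset.mem_symmDiff, Finset.mem_singleton, Finset.mem_erase]
  constructor
  · rintro (⟨hq, hne⟩ | ⟨rfl, hq⟩)
    · exact ⟨hne, hq⟩
    · exact absurd hi hq
  · rintro ⟨hne, hq⟩
    exact Or.inl ⟨hq, hne⟩

omit [Fintype ι] [Fintype ι'] in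
/-- For a colour `i ∉ B`, `Bᶜ.erase i` is the complement of `B ∆ {i} = insert i B`. [folklore] -/
theorem mem_compl_erase_iff [Fintype Q] {B : Finset Q} {i : Q} (hi : i ∉ B) (q : Q) :
    q ∈ Bᶜ.erase i ↔ q ∉ symmDiff B {i} := by
  simp only [Finset.mem_erase, Finset.mem_compl, Finset.mem_symmDiff, Finset.mem_singleton]
  constructor
  · rintro ⟨hne, hq⟩ (⟨hq', -⟩ | ⟨hqi, -⟩)
    · exact hq hq'
    · exact hne hqi
  · intro h
    refine ⟨fun hqi => h (Or.inr ⟨hqi, ?_⟩), fun hq => h (Or.inl ⟨hq, ?_⟩)⟩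
    · rw [hqi]; exact hi
    · rintro rfl; exact hi hq

omit [Fintype ι] in
/-- P-SIDE PREMISE.  For `i ∈ B` the single-removal cut `μ(B.erase i)` equals `μ(B ∆ {i})`, so the premise of the one-sided
decomposition with slack `δ i := μ(B ∆ {i}) − μ(B)` holds (with equality). [folklore] -/
theorem premise_of_mem (row : ι → Q) (col : ι' → Q) (R : Matrix ι ι' K) (B : Finset Q) {i : Q} (hi : i ∈ B) :
    (((Matrix.of fun x y => if row x ∈ B.erase i ∧ col y ∉ B.erase i then R x y else 0).rank : ℤ) +
        ((Matrix.of fun x y => if row x ∉ B.erase i ∧ col y ∈ B.erase i then R x y else 0).rank : ℤ)) ≤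
      ((Matrix.of fun x y => if row x ∈ B ∧ col y ∉ B then R x y else 0).rank : ℤ) +
        ((Matrix.of fun x y => if row x ∉ B ∧ col y ∈ B then R x y else 0).rank : ℤ) +
        ((((Matrix.of fun x y => if row x ∈ symmDiff B {i} ∧ col y ∉ symmDiff B {i} then R x y else 0).rank : ℤ) +
            ((Matrix.of fun x y => if row x ∉ symmDiff B {i} ∧ col y ∈ symmDiff B {i} then R x y else 0).rank : ℤ)) -
          (((Matrix.of fun x y => if row x ∈ B ∧ col y ∉ B then R x y else 0).rank : ℤ) +
            ((Matrix.of fun x y => if row x ∉ B ∧ col y ∈ B then R x y else 0).rank : ℤ))) := by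
  rw [symmDiff_singleton_eq_erase_of_mem hi]
  omega

omit [Fintype ι] in
/-- T-SIDE PREMISE.  For `i ∉ B` the single-removal cut of the complement, `μ(Bᶜ.erase i)`, is `μ(B ∆ {i})` with its two
blocks exchanged, and `μ(Bᶜ)` is `μ(B)` with its two blocks exchanged; so the premise of the one-sided decomposition for
`Bᶜ` with slack `δ i := μ(B ∆ {i}) − μ(B)` holds (with equality). [folklore] -/
theorem premise_of_mem_compl [Fintype Q] (row : ι → Q) (col : ι' → Q) (R : Matrix ι ι' K) (B : Finset Q) {i : Q}
    (hi : i ∈ Bᶜ) :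
    (((Matrix.of fun x y => if row x ∈ Bᶜ.erase i ∧ col y ∉ Bᶜ.erase i then R x y else 0).rank : ℤ) +
        ((Matrix.of fun x y => if row x ∉ Bᶜ.erase i ∧ col y ∈ Bᶜ.erase i then R x y else 0).rank : ℤ)) ≤
      ((Matrix.of fun x y => if row x ∈ Bᶜ ∧ col y ∉ Bᶜ then R x y else 0).rank : ℤ) +
        ((Matrix.of fun x y => if row x ∉ Bᶜ ∧ col y ∈ Bᶜ then R x y else 0).rank : ℤ) +
        ((((Matrix.of fun x y => if row x ∈ symmDiff B {i} ∧ col y ∉ symmDiff B {i} then R x y else 0).rank : ℤ) +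
            ((Matrix.of fun x y => if row x ∉ symmDiff B {i} ∧ col y ∈ symmDiff B {i} then R x y else 0).rank : ℤ)) -
          (((Matrix.of fun x y => if row x ∈ B ∧ col y ∉ B then R x y else 0).rank : ℤ) +
            ((Matrix.of fun x y => if row x ∉ B ∧ col y ∈ B then R x y else 0).rank : ℤ))) := by
  have hi' : i ∉ B := Finset.mem_compl.mp hi
  have e1 : (Matrix.of fun x y => if row x ∈ Bᶜ.erase i ∧ col y ∉ Bᶜ.erase i then R x y else 0) =
      Matrix.of fun x y => if row x ∉ symmDiff B {i} ∧ col y ∈ symmDiff B {i} then R x y else 0 := by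
    ext x y
    simp only [Matrix.of_apply, mem_compl_erase_iff hi', not_not]
  have e2 : (Matrix.of fun x y => if row x ∉ Bᶜ.erase i ∧ col y ∈ Bᶜ.erase i then R x y else 0) =
      Matrix.of fun x y => if row x ∈ symmDiff B {i} ∧ col y ∉ symmDiff B {i} then R x y else 0 := by
    ext x y
    simp only [Matrix.of_apply, mem_compl_erase_iff hi', not_not]
  have cQ : (Matrix.of fun x y => if row x ∈ Bᶜ ∧ col y ∉ Bᶜ then R x y else 0) =
      Matrix.of fun x y => if row x ∉ B ∧ col y ∈ B then R x y else 0 := by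
    ext x y
    simp only [Matrix.of_apply, Finset.mem_compl, not_not]
  have cS : (Matrix.of fun x y => if row x ∉ Bᶜ ∧ col y ∈ Bᶜ then R x y else 0) =
      Matrix.of fun x y => if row x ∈ B ∧ col y ∉ B then R x y else 0 := by
    ext x y
    simp only [Matrix.of_apply, Finset.mem_compl, not_not]
  rw [e1, e2, cQ, cS]
  omega

/-- ASSEMBLY (the pattern of `…CutLemma.exists_blockDiagonal_of_maxCut`, p642852).  From a colour-block-diagonal
approximation `P₁` of the super-block `blk(B,B)` (supported on `{row = col ∈ B}`) and one `P₂` of `blk(Bᶜ,Bᶜ)` (supported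
on `{row = col ∈ Bᶜ}`), `R' := P₁ + P₂` is supported on the equal-colour cells and
`rank (R − R') ≤ μ(B) + rank (blk(B,B) − P₁) + rank (blk(Bᶜ,Bᶜ) − P₂)`; with the two one-sided bounds
`2·rank blk(B,Bᶜ) + rank blk(Bᶜ,B) + ∑_{i∈B} δ i` and `2·rank blk(Bᶜ,B) + rank blk(B,Bᶜ) + ∑_{i∈Bᶜ} δ i` this is
`4 μ(B) + ∑_i δ i`. [folklore] -/
theorem assemble [Fintype Q] (row : ι → Q) (col : ι' → Q) (R : Matrix ι ι' K) (B : Finset Q) (δ : Q → ℤ)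
    (P₁ P₂ : Matrix ι ι' K)
    (hP₁s : ∀ x y, ¬ (row x = col y ∧ col y ∈ B) → P₁ x y = 0)
    (hP₁ : (((Matrix.of fun x y => if row x ∈ B ∧ col y ∈ B then R x y else 0) - P₁).rank : ℤ) ≤
      2 * ((Matrix.of fun x y => if row x ∈ B ∧ col y ∉ B then R x y else 0).rank : ℤ) +
        ((Matrix.of fun x y => if row x ∉ B ∧ col y ∈ B then R x y else 0).rank : ℤ) + ∑ i ∈ B, δ i)
    (hP₂s : ∀ x y, ¬ (row x = col y ∧ col y ∈ Bᶜ) → P₂ x y = 0)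
    (hP₂ : (((Matrix.of fun x y => if row x ∈ Bᶜ ∧ col y ∈ Bᶜ then R x y else 0) - P₂).rank : ℤ) ≤
      2 * ((Matrix.of fun x y => if row x ∈ Bᶜ ∧ col y ∉ Bᶜ then R x y else 0).rank : ℤ) +
        ((Matrix.of fun x y => if row x ∉ Bᶜ ∧ col y ∈ Bᶜ then R x y else 0).rank : ℤ) + ∑ i ∈ Bᶜ, δ i) :
    ∃ R' : Matrix ι ι' K, (∀ x y, row x ≠ col y → R' x y = 0) ∧
      ((R - R').rank : ℤ) ≤
        4 * (((Matrix.of fun x y => if row x ∈ B ∧ col y ∉ B then R x y else 0).rank : ℤ) +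
            ((Matrix.of fun x y => if row x ∉ B ∧ col y ∈ B then R x y else 0).rank : ℤ)) + ∑ i, δ i := by
  set Qm : Matrix ι ι' K := Matrix.of fun x y => if row x ∈ B ∧ col y ∉ B then R x y else 0 with hQm
  set Sm : Matrix ι ι' K := Matrix.of fun x y => if row x ∉ B ∧ col y ∈ B then R x y else 0 with hSm
  set Pm : Matrix ι ι' K := Matrix.of fun x y => if row x ∈ B ∧ col y ∈ B then R x y else 0 with hPm
  set Tm : Matrix ι ι' K := Matrix.of fun x y => if row x ∈ Bᶜ ∧ col y ∈ Bᶜ then R x y else 0 with hTm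
  -- the complement has the same cut, with the two blocks exchanged
  have cQ : (Matrix.of fun x y => if row x ∈ Bᶜ ∧ col y ∉ Bᶜ then R x y else 0) = Sm := by
    ext x y
    simp only [hSm, Matrix.of_apply, Finset.mem_compl, not_not]
  have cS : (Matrix.of fun x y => if row x ∉ Bᶜ ∧ col y ∈ Bᶜ then R x y else 0) = Qm := by
    ext x y
    simp only [hQm, Matrix.of_apply, Finset.mem_compl, not_not]
  rw [cQ, cS] at hP₂
  refine ⟨P₁ + P₂, fun x y hxy => ?_, ?_⟩
  · rw [Matrix.add_apply, hP₁s x y (fun h => hxy h.1), hP₂s x y (fun h => hxy h.1), add_zero]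
  have hR : R - (P₁ + P₂) = (Qm + Sm) + ((Pm - P₁) + (Tm - P₂)) := by
    have : R = Pm + Qm + Sm + Tm := by
      ext x y
      simp only [hPm, hQm, hSm, hTm, Matrix.add_apply, Matrix.of_apply, Finset.mem_compl]
      by_cases hx : row x ∈ B <;> by_cases hy : col y ∈ B <;> simp [hx, hy]
    rw [this]; abel
  have r0 : (((Qm + Sm) + ((Pm - P₁) + (Tm - P₂))).rank : ℤ) ≤
      ((Qm + Sm).rank : ℤ) + (((Pm - P₁) + (Tm - P₂)).rank : ℤ) := by
    exact_mod_cast rank_add_le _ _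
  have r1 : ((Qm + Sm).rank : ℤ) ≤ (Qm.rank : ℤ) + (Sm.rank : ℤ) := by
    exact_mod_cast rank_add_le _ _
  have r2 : (((Pm - P₁) + (Tm - P₂)).rank : ℤ) ≤ ((Pm - P₁).rank : ℤ) + ((Tm - P₂).rank : ℤ) := by
    exact_mod_cast rank_add_le _ _
  have hsplit : ∑ i ∈ B, δ i + ∑ i ∈ Bᶜ, δ i = ∑ i, δ i := Finset.sum_add_sum_compl B δ
  rw [hR]
  linarith

/-- **The local cut inequality** — registered stub `stub_localCut` (W12) of line `rank-dehn-ladder` (crux stmt-PneNP-18923),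
signature verbatim from `Cruxes/RankDefectRepresentations/Lines/rank_dehn_ladder.lean` (RESHAPE 13): the one-sided
decomposition with signed slack (stub `stub_oneSidedSlack`, W11 — the hypothesis) implies that for EVERY set of colours
`B`, `R` is within rank `4 μ(B) + ∑_{i : Q} (μ(B ∆ {i}) − μ(B))` of a matrix supported on the equal-colour cells.  Proof:
the hypothesis at `B` (`premise_of_mem`) and at `Bᶜ` (`premise_of_mem_compl`) with `δ i := μ(B ∆ {i}) − μ(B)`, then
`assemble`. [folklore] -/
theorem stub_localCut :
    (∀ (K : Type) [Field K] (ι ι' Q : Type) [Fintype ι] [Fintype ι'] [DecidableEq ι] [DecidableEq ι'] [DecidableEq Q]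
      (row : ι → Q) (col : ι' → Q) (R : Matrix ι ι' K) (B : Finset Q) (δ : Q → ℤ),
      (∀ i ∈ B,
        (((Matrix.of fun x y => if row x ∈ B.erase i ∧ col y ∉ B.erase i then R x y else 0).rank : ℤ) +
          ((Matrix.of fun x y => if row x ∉ B.erase i ∧ col y ∈ B.erase i then R x y else 0).rank : ℤ)) ≤
        ((Matrix.of fun x y => if row x ∈ B ∧ col y ∉ B then R x y else 0).rank : ℤ) +
          ((Matrix.of fun x y => if row x ∉ B ∧ col y ∈ B then R x y else 0).rank : ℤ) + δ i) →
      ∃ P'' : Matrix ι ι' K, (∀ x y, ¬ (row x = col y ∧ col y ∈ B) → P'' x y = 0) ∧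
        (((Matrix.of fun x y => if row x ∈ B ∧ col y ∈ B then R x y else 0) - P'').rank : ℤ) ≤
          2 * ((Matrix.of fun x y => if row x ∈ B ∧ col y ∉ B then R x y else 0).rank : ℤ) +
            ((Matrix.of fun x y => if row x ∉ B ∧ col y ∈ B then R x y else 0).rank : ℤ) + ∑ i ∈ B, δ i) →
    ∀ (K : Type) [Field K] (ι ι' Q : Type) [Fintype ι] [Fintype ι'] [DecidableEq ι] [DecidableEq ι'] [Fintype Q] [DecidableEq Q]
      (row : ι → Q) (col : ι' → Q) (R : Matrix ι ι' K) (B : Finset Q),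
      ∃ R' : Matrix ι ι' K, (∀ x y, row x ≠ col y → R' x y = 0) ∧
        ((R - R').rank : ℤ) ≤
          4 * (((Matrix.of fun x y => if row x ∈ B ∧ col y ∉ B then R x y else 0).rank : ℤ) +
              ((Matrix.of fun x y => if row x ∉ B ∧ col y ∈ B then R x y else 0).rank : ℤ)) +
          ∑ i : Q, ((((Matrix.of fun x y => if row x ∈ symmDiff B {i} ∧ col y ∉ symmDiff B {i} then R x y else 0).rank : ℤ) +
              ((Matrix.of fun x y => if row x ∉ symmDiff B {i} ∧ col y ∈ symmDiff B {i} then R x y else 0).rank : ℤ)) -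
            (((Matrix.of fun x y => if row x ∈ B ∧ col y ∉ B then R x y else 0).rank : ℤ) +
              ((Matrix.of fun x y => if row x ∉ B ∧ col y ∈ B then R x y else 0).rank : ℤ))) := by
  intro hOS K _ ι ι' Q _ _ _ _ _ _ row col R B
  obtain ⟨P₁, hP₁s, hP₁⟩ := hOS K ι ι' Q row col R B
    (fun i => (((Matrix.of fun x y => if row x ∈ symmDiff B {i} ∧ col y ∉ symmDiff B {i} then R x y else 0).rank : ℤ) +
        ((Matrix.of fun x y => if row x ∉ symmDiff B {i} ∧ col y ∈ symmDiff B {i} then R x y else 0).rank : ℤ)) -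
      (((Matrix.of fun x y => if row x ∈ B ∧ col y ∉ B then R x y else 0).rank : ℤ) +
        ((Matrix.of fun x y => if row x ∉ B ∧ col y ∈ B then R x y else 0).rank : ℤ)))
    (fun i hi => premise_of_mem row col R B hi)
  obtain ⟨P₂, hP₂s, hP₂⟩ := hOS K ι ι' Q row col R Bᶜ
    (fun i => (((Matrix.of fun x y => if row x ∈ symmDiff B {i} ∧ col y ∉ symmDiff B {i} then R x y else 0).rank : ℤ) +
        ((Matrix.of fun x y => if row x ∉ symmDiff B {i} ∧ col y ∈ symmDiff B {i} then R x y else 0).rank : ℤ)) -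
      (((Matrix.of fun x y => if row x ∈ B ∧ col y ∉ B then R x y else 0).rank : ℤ) +
        ((Matrix.of fun x y => if row x ∉ B ∧ col y ∈ B then R x y else 0).rank : ℤ)))
    (fun i hi => premise_of_mem_compl row col R B hi)
  exact assemble row col R B _ P₁ P₂ hP₁s hP₁ hP₂s hP₂

end Summit.PneNP.PneNP.Theorems.CnfIdealGenLengthRankDefectRepresentationsLocalCut
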